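import Summits.Schanuel.Schanuel.Theorems.DiophantineDichotomyApproximationPropertyPointAPThreeConditional
import HarnessLib

/-!
# The crux `ApproximationProperty` from its three named residuals (stmt-Schanuel-6117, line `orbit-interpolation-determinant`)

Crux `stmt-Schanuel-6117` (`Summit.Schanuel.Schanuel.Theses.DiophantineDichotomy.ApproximationProperty`),
route `DiophantineDichotomy`, line `orbit-interpolation-determinant`, lead c6
(`prover-line-stmt-Schanuel-6117-c6-0`, skeleton v15 `Cruxes/ApproximationProperty/Lines/orbit_interpolation_determinant.lean`).

This file LANDS, as theorems with explicit hypotheses (no `sorry`, no new definition, no named fact),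
the whole kernel-checked composition of skeleton v15: Philippon's approximation property in EVERY
transcendence degree `t ≥ 1` (the crux, by name) follows from exactly the three statements that the
skeleton still carries as `sorry`d stubs, each taken here as a hypothesis spelled out verbatim:
* `IsolatedPointClause3` (…CycleAPIAt3Defs.lean) — the dimension-`0` case of Chardin–Philippon's
  regularity theorem for three forms of `ℚ[x₀, …, x₃]` (J. Algebraic Geom. 8 (1999) 471–481, erratum
  11 (2002) 599–600): in print, not in the tree;
* the far-satellite datum beyond a threshold (registered stub `pointDatum_of_farSatellite3_beyond`,
  hypothesis `hfar`): ≈ Philippon's AP2 at `n = 3` for long orbits of the clause-free descent lying on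
  a satellite of degree `> δ⋆` of the cut-2 complete intersection — OPEN in print (LNM 1752 Ch. 4 §4
  p. 61 proves AP2 for `n ≤ 2` only);
* `∀ t ≥ 4, PointAPAbsAt t` (registered stub `stub_pointAP_four_le`, hypothesis `h4`): AP2 in
  dimension `≥ 4`, containing Philippon's conjecture AP1(`d' = 0`, `n ≥ 4`) — OPEN.
Everything else is in the tree (`t ≤ 2` unconditionally: `slice_one`, `slice_two`; `t = 3`:
`pointAPAt3_of`, p129486; lifting `stub_lift`, p85884).

Main results: `approximationProperty_of_pointAP_three_le` (the crux reduces EXACTLY to the point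
property in dimensions `≥ 3`), `pointAP_three_le_of_residuals`, `approximationProperty_of_residuals`
(registered sub-goals of the crux item). This is the tree-level record of what the line has reduced the
crux to; closing any hypothesis closes the corresponding stub of the skeleton by name.

Sources: NesterenkoPhilippon2001 (LNM 1752) Ch. 4 §4 p. 61; Philippon2000; ChardinPhilippon1999;
LaurentRoy1999 Thm 1.
-/

set_option linter.dupNamespace false

namespace Summit.Schanuel.Schanuel.Cruxes.ApproximationProperty.OrbitInterpolationDeterminant

open Summit.Schanuel.Schanuel.Theses.DiophantineDichotomy
open Literature.NumberTheory.Transcendental.Nesterenko MvPolynomial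

attribute [local instance] MvPolynomial.gradedAlgebra

noncomputable section

/-- **The crux reduces exactly to the point property in dimensions `≥ 3`**: with the landed `t ≤ 2`
point properties (`PointAPThreeConditional.pointAP_le_two`: `CycleAPIAt 1, 2` + dictionary + lever +
sharp closest point + `stub_pointAP`) and the landed lifting `stub_lift`, `PointAPAbsAt t` for every
`t ≥ 3` gives `ApproximationProperty` (all `θ ∈ ℂ^ι`, all `t ≥ 1` with `trdeg_ℚ ℚ(θ) ≤ t`).
[cite: NesterenkoPhilippon2001, Ch. 4 §4 p. 61 (AP1 ⇒ AP2 ⇒ lifting scheme); LaurentRoy1999, Thm 1] -/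
theorem approximationProperty_of_pointAP_three_le :
    (∀ t : ℕ, 3 ≤ t → PointAPAbsAt t) → ApproximationProperty := by
  intro hP
  exact pointwiseAP_iff.mp (pointwiseAP_iff_slice.mpr fun t ht =>
    stub_lift t ht fun t₀ h₀ _ =>
      if h₂ : t₀ ≤ 2 then PointAPThreeConditional.pointAP_le_two t₀ h₀ h₂ else hP t₀ (by omega))

/-- **The point property in every dimension `t ≥ 3` from the three residuals**: `t = 3` is the landed
conditional `pointAPAt3_of` (Chardin–Philippon dim 0 + the far-satellite datum), `t ≥ 4` is the
hypothesis `h4` (Philippon's conjecture). [cite: NesterenkoPhilippon2001, Ch. 4 §4 p. 61] -/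
theorem pointAP_three_le_of_residuals : IsolatedPointClause3 → (∀ (ω : Fin 3 → ℂ) (c₁ : ℝ), 1 ≤ c₁ → ∃ δstar : ℕ, 1 ≤ δstar ∧ ∃ lam : ℝ, 1 ≤ lam ∧ ∃ c : ℝ, c₁ ≤ c ∧ ∀ Δ Y : ℝ, c ≤ Δ → Δ ≤ Y → ∀ (Q : Rx 3) (a : ℕ) (P : Rx 3) (b : ℕ) (𝔮 : Ideal (Rx 3)) (T : Rx 3) (τ : ℕ) (𝔭 𝔮' : Ideal (Rx 3)), CycleAP3Datum ω c₁ Δ (lam * Y) Q a P b 𝔮 T τ 𝔭 → 𝔮'.IsPrime → 𝔮'.IsHomogeneous (homogeneousSubmodule (Fin (3 + 1)) ℚ) → IsUnmixedOfRank 𝔮' 2 → 𝔮' ∈ (Ideal.span {Q} ⊔ Ideal.span {P}).minimalPrimes → Ideal.span {Q} ⊔ Ideal.span {P} ⊔ Ideal.span {T} ≤ 𝔮' → 𝔮' < 𝔭 → δstar < ideg 𝔮' 2 → ⌊c₁ * Δ⌋₊ + 1 < ideg 𝔭 1 → ¬ (Module.finrank ℚ ↥(homogeneousSubmodule (Fin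 (3 + 1)) ℚ ⌊c₁ * Δ⌋₊) = Module.finrank ℚ ↥(homogeneousSubmodule (Fin (3 + 1)) ℚ ⌊c₁ * Δ⌋₊ ⊓ 𝔭.restrictScalars ℚ) + ideg 𝔭 1) → ∃ (K : Type) (_ : Field K) (_ : NumberField K) (β : Fin 3 → K) (σ : K →+* ℂ), (Module.finrank ℚ K : ℝ) ≤ (c * Δ) ^ 3 ∧ Height.logHeight (Fin.cons (1 : K) β : Fin (3 + 1) → K) ≤ c * Y * Δ ^ 2 ∧ ‖(fun j => σ (β j)) - ω‖ ≤ Real.exp (-((Δ * Height.logHeight (Fin.cons (1 : K) β : Fin (3 + 1) → K) + Y * Module.finrank ℚ K) / c))) → (∀ t : ℕ, 4 ≤ t → PointAPAbsAt t) → ∀ t : ℕ, 3 ≤ t → PointAPAbsAt t := by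
  intro hCP hfar h4 t ht
  by_cases e₃ : t = 3
  · subst e₃
    exact pointAPAt3_of hCP hfar
  · exact h4 t (by omega)

/-- **The crux from its three named residuals** — the tree-level record of skeleton v15 of line
`orbit-interpolation-determinant`: Chardin–Philippon's dimension-`0` regularity for three forms of
`ℚ[x₀, …, x₃]` (`IsolatedPointClause3`), the far-satellite datum beyond a threshold (`hfar`, the open
kernel of the `t = 3` transfer) and the point property in dimension `≥ 4` (`h4`, Philippon's conjecture)
together give `ApproximationProperty` BY NAME. No other hypothesis; `t ≤ 2` and the whole `t = 3` case
tree are landed theorems. [cite: NesterenkoPhilippon2001, Ch. 4 §4 p. 61; ChardinPhilippon1999] -/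
theorem approximationProperty_of_residuals : IsolatedPointClause3 → (∀ (ω : Fin 3 → ℂ) (c₁ : ℝ), 1 ≤ c₁ → ∃ δstar : ℕ, 1 ≤ δstar ∧ ∃ lam : ℝ, 1 ≤ lam ∧ ∃ c : ℝ, c₁ ≤ c ∧ ∀ Δ Y : ℝ, c ≤ Δ → Δ ≤ Y → ∀ (Q : Rx 3) (a : ℕ) (P : Rx 3) (b : ℕ) (𝔮 : Ideal (Rx 3)) (T : Rx 3) (τ : ℕ) (𝔭 𝔮' : Ideal (Rx 3)), CycleAP3Datum ω c₁ Δ (lam * Y) Q a P b 𝔮 T τ 𝔭 → 𝔮'.IsPrime → 𝔮'.IsHomogeneous (homogeneousSubmodule (Fin (3 + 1)) ℚ) → IsUnmixedOfRank 𝔮' 2 → 𝔮' ∈ (Ideal.span {Q} ⊔ Ideal.span {P}).minimalPrimes → Ideal.span {Q} ⊔ Ideal.span {P} ⊔ Ideal.span {T} ≤ 𝔮' → 𝔮' < 𝔭 → δstar < ideg 𝔮' 2 → ⌊c₁ * Δ⌋₊ + 1 < ideg 𝔭 1 → ¬ (Module.finrank ℚ ↥(homogeneousSubmodule (Fin (3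 + 1)) ℚ ⌊c₁ * Δ⌋₊) = Module.finrank ℚ ↥(homogeneousSubmodule (Fin (3 + 1)) ℚ ⌊c₁ * Δ⌋₊ ⊓ 𝔭.restrictScalars ℚ) + ideg 𝔭 1) → ∃ (K : Type) (_ : Field K) (_ : NumberField K) (β : Fin 3 → K) (σ : K →+* ℂ), (Module.finrank ℚ K : ℝ) ≤ (c * Δ) ^ 3 ∧ Height.logHeight (Fin.cons (1 : K) β : Fin (3 + 1) → K) ≤ c * Y * Δ ^ 2 ∧ ‖(fun j => σ (β j)) - ω‖ ≤ Real.exp (-((Δ * Height.logHeight (Fin.cons (1 : K) β : Fin (3 + 1) → K) + Y * Module.finrank ℚ K) / c))) → (∀ t : ℕ, 4 ≤ t → PointAPAbsAt t) → ApproximationProperty := by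
  intro hCP hfar h4
  exact approximationProperty_of_pointAP_three_le (pointAP_three_le_of_residuals hCP hfar h4)

end

end Summit.Schanuel.Schanuel.Cruxes.ApproximationProperty.OrbitInterpolationDeterminant
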